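import Mathlib
import HarnessLib

/-!
# Cycle heat kernel — basic facts (helper for stub `stub_treeRatioFloor`, crux stmt-QuantumFields-9365)

The tree-level ratio floor compares the transverse torus propagator at an axis point and at a diagonal point.
Its proof runs through the heat-kernel representation of the propagator, whose building block is the
continuous-time simple-random-walk kernel on the `L`-cycle in Fourier form,
`q(s,m) = (1/L) ∑_{k ∈ ZMod L} exp(-s k̂²) cos(2π k m/L)`, `k̂² = ε(k) = 2 - 2cos(2πk/L)`,
together with the weight `w(s) = (1/L) ∑_k ε(k) exp(-s ε(k))`.

Theorems only: the kernel is carried as functions `ε q w` constrained by their defining equations (`hε`, `hq`,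
`hw`), instantiated by the explicit sums at the very end.  Contents: folding `k ↦ κ = |valMinAbs k| ∈ [0, L/2]`
inside the cosines, `16κ²/L² ≤ ε(k) ≤ 4π²κ²/L²` (Jordan), `1 - cos(2πkx/L) ≤ 2π²κ²x²/L²`, the folding estimate
`∑_{k} g(κ_k) ≤ 2 ∑_{j ≤ L/2} g(j)` (registered as `CycleFoldingEstimate`), and the kernel facts
`|q(s,m)| ≤ q(s,0) ≤ 1`, `1/L ≤ q(s,0)`, `0 ≤ w(s) ≤ 4 exp(-16 s/L²) ≤ 4`, evenness, vanishing sine sums, continuity.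
-/

noncomputable section

namespace Summit.QuantumFields.YangMills.Theorems.FemtoCurvatureSkewness

open Finset
open scoped BigOperators

namespace CycleKernel

variable {L : ℕ} [NeZero L]

/-! ## Folding residues into `[0, L/2]` -/

/-- Cosines against integer frequencies only see the folded representative
`κ = |valMinAbs k| = min(k.val, L - k.val)`: `cos(2π k.val x/L) = cos(2π κ x/L)` for `x ∈ ℤ`. -/
theorem cos_fold (k : ZMod L) (x : ℤ) :
    Real.cos (2 * Real.pi * (k.val : ℝ) * x / L) =
      Real.cos (2 * Real.pi * (k.valMinAbs.natAbs : ℝ) * x / L) := by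
  have hL : (L : ℝ) ≠ 0 := Nat.cast_ne_zero.mpr (NeZero.ne L)
  rw [ZMod.valMinAbs_natAbs_eq_min]
  rcases le_total k.val (L - k.val) with h | h
  · rw [min_eq_left h]
  · rw [min_eq_right h, Nat.cast_sub (ZMod.val_lt k).le]
    have e : 2 * Real.pi * ((L : ℝ) - (k.val : ℝ)) * x / L =
        (x : ℝ) * (2 * Real.pi) - 2 * Real.pi * (k.val : ℝ) * x / L := by
      field_simp
    rw [e, Real.cos_int_mul_two_pi_sub]

/-- Folding at frequency one: `cos(2π k.val/L) = cos(2π κ/L)`. -/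
theorem cos_fold_one (k : ZMod L) :
    Real.cos (2 * Real.pi * (k.val : ℝ) / L) = Real.cos (2 * Real.pi * (k.valMinAbs.natAbs : ℝ) / L) := by
  simpa using cos_fold k 1

/-- The folded representative lies in `[0, L/2]` (as reals). -/
theorem fold_le_half (k : ZMod L) : (k.valMinAbs.natAbs : ℝ) ≤ (L : ℝ) / 2 := by
  have h := ZMod.natAbs_valMinAbs_le k
  have h2 : ((L / 2 : ℕ) : ℝ) ≤ (L : ℝ) / 2 := Nat.cast_div_le
  exact le_trans (by exact_mod_cast h) h2

omit [NeZero L] in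
/-- The folded representative vanishes only at `k = 0`. -/
theorem one_le_fold {k : ZMod L} (hk : k ≠ 0) : 1 ≤ k.valMinAbs.natAbs := by
  rcases Nat.eq_zero_or_pos k.valMinAbs.natAbs with h | h
  · exact absurd ((ZMod.valMinAbs_eq_zero k).mp (Int.natAbs_eq_zero.mp h)) hk
  · exact h

omit [NeZero L] in
/-- A small natural number is its own folded representative. -/
theorem fold_natCast {n : ℕ} (hn : n ≤ L / 2) : ((n : ZMod L).valMinAbs).natAbs = n := by
  rw [ZMod.valMinAbs_natCast_of_le_half hn, Int.natAbs_natCast]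

/-! ## The dispersion `ε(k) = 2 - 2cos(2πk/L) = 4 sin²(πκ/L)` -/

/-- `ε(k) = 4 sin²(πκ/L)`. -/
theorem eps_eq_sin_sq (k : ZMod L) :
    2 - 2 * Real.cos (2 * Real.pi * (k.val : ℝ) / L) =
      4 * Real.sin (Real.pi * (k.valMinAbs.natAbs : ℝ) / L) ^ 2 := by
  rw [cos_fold_one, Real.sin_sq]
  have e : 2 * Real.pi * (k.valMinAbs.natAbs : ℝ) / L = 2 * (Real.pi * (k.valMinAbs.natAbs : ℝ) / L) := by ring
  rw [e, Real.cos_two_mul]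
  ring

omit [NeZero L] in
/-- `0 ≤ ε(k)`. -/
theorem eps_nonneg (k : ZMod L) : 0 ≤ 2 - 2 * Real.cos (2 * Real.pi * (k.val : ℝ) / L) := by
  have := Real.cos_le_one (2 * Real.pi * (k.val : ℝ) / L)
  linarith

omit [NeZero L] in
/-- `ε(k) ≤ 4`. -/
theorem eps_le_four (k : ZMod L) : 2 - 2 * Real.cos (2 * Real.pi * (k.val : ℝ) / L) ≤ 4 := by
  have := Real.neg_one_le_cos (2 * Real.pi * (k.val : ℝ) / L)
  linarith

/-- Upper dispersion bound `ε(k) ≤ 4π²κ²/L²` (`sin u ≤ u`). -/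
theorem eps_le_sq (k : ZMod L) :
    2 - 2 * Real.cos (2 * Real.pi * (k.val : ℝ) / L) ≤
      4 * Real.pi ^ 2 * (k.valMinAbs.natAbs : ℝ) ^ 2 / (L : ℝ) ^ 2 := by
  have hL : (0 : ℝ) < L := by exact_mod_cast NeZero.pos L
  rw [eps_eq_sin_sq]
  set u : ℝ := Real.pi * (k.valMinAbs.natAbs : ℝ) / L with hu
  have hu0 : 0 ≤ u := by rw [hu]; positivity
  have hupi : u ≤ Real.pi := by
    rw [hu, div_le_iff₀ hL]
    have h := fold_le_half k
    nlinarith [Real.pi_pos]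
  have hs0 : 0 ≤ Real.sin u := Real.sin_nonneg_of_nonneg_of_le_pi hu0 hupi
  have hs1 : Real.sin u ≤ u := Real.sin_le hu0
  have e : 4 * Real.pi ^ 2 * (k.valMinAbs.natAbs : ℝ) ^ 2 / (L : ℝ) ^ 2 = 4 * u ^ 2 := by
    rw [hu]; field_simp
  rw [e]
  nlinarith

/-- Lower dispersion bound `16κ²/L² ≤ ε(k)` (Jordan's inequality `(2/π)u ≤ sin u` on `[0, π/2]`). -/
theorem sq_le_eps (k : ZMod L) :
    16 * (k.valMinAbs.natAbs : ℝ) ^ 2 / (L : ℝ) ^ 2 ≤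
      2 - 2 * Real.cos (2 * Real.pi * (k.val : ℝ) / L) := by
  have hL : (0 : ℝ) < L := by exact_mod_cast NeZero.pos L
  rw [eps_eq_sin_sq]
  set u : ℝ := Real.pi * (k.valMinAbs.natAbs : ℝ) / L with hu
  have hu0 : 0 ≤ u := by rw [hu]; positivity
  have hupi : u ≤ Real.pi / 2 := by
    rw [hu, div_le_iff₀ hL]
    have h := fold_le_half k
    nlinarith [Real.pi_pos]
  have hj : 2 / Real.pi * u ≤ Real.sin u := Real.mul_le_sin hu0 hupi
  have hj0 : 0 ≤ 2 / Real.pi * u := by positivity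
  have e : 16 * (k.valMinAbs.natAbs : ℝ) ^ 2 / (L : ℝ) ^ 2 = 4 * (2 / Real.pi * u) ^ 2 := by
    rw [hu]; field_simp; ring
  rw [e]
  nlinarith

/-- `1 - cos(2π k x/L) ≤ 2π²κ²x²/L²` for integer frequencies `x` (`1 - cos y ≤ y²/2` after folding). -/
theorem one_sub_cos_le (k : ZMod L) (x : ℤ) :
    1 - Real.cos (2 * Real.pi * (k.val : ℝ) * x / L) ≤
      2 * Real.pi ^ 2 * (k.valMinAbs.natAbs : ℝ) ^ 2 * (x : ℝ) ^ 2 / (L : ℝ) ^ 2 := by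
  have hL : (L : ℝ) ≠ 0 := Nat.cast_ne_zero.mpr (NeZero.ne L)
  rw [cos_fold]
  have h := Real.one_sub_sq_div_two_le_cos (x := 2 * Real.pi * (k.valMinAbs.natAbs : ℝ) * x / L)
  have e : (2 * Real.pi * (k.valMinAbs.natAbs : ℝ) * x / L) ^ 2 / 2 =
      2 * Real.pi ^ 2 * (k.valMinAbs.natAbs : ℝ) ^ 2 * (x : ℝ) ^ 2 / (L : ℝ) ^ 2 := by
    field_simp
  linarith

/-- Gaussian domination of the Fourier weights: `exp(-s ε(k)) ≤ exp(-16 s κ²/L²)` for `s ≥ 0`. -/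
theorem exp_eps_le (k : ZMod L) {s : ℝ} (hs : 0 ≤ s) :
    Real.exp (-(s * (2 - 2 * Real.cos (2 * Real.pi * (k.val : ℝ) / L)))) ≤
      Real.exp (-(16 * s / (L : ℝ) ^ 2 * (k.valMinAbs.natAbs : ℝ) ^ 2)) := by
  rw [Real.exp_le_exp, neg_le_neg_iff]
  have h := mul_le_mul_of_nonneg_left (sq_le_eps k) hs
  have e : s * (16 * (k.valMinAbs.natAbs : ℝ) ^ 2 / (L : ℝ) ^ 2) =
      16 * s / (L : ℝ) ^ 2 * (k.valMinAbs.natAbs : ℝ) ^ 2 := by ring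
  linarith

/-! ## Folding sums over `ZMod L` -/

/-- **Folding estimate.** For non-negative `g`, `∑_{k ∈ ZMod L} g(κ_k) ≤ 2 ∑_{j=0}^{L/2} g(j)`: each folded value
`j` is hit by at most the two residues `j` and `L - j`. -/
theorem sum_fold_le (g : ℕ → ℝ) (hg : ∀ j, 0 ≤ g j) :
    ∑ k : ZMod L, g k.valMinAbs.natAbs ≤ 2 * ∑ j ∈ range (L / 2 + 1), g j := by
  -- re-index by the representative `v = k.val ∈ [0, L)`
  have h1 : ∑ k : ZMod L, g k.valMinAbs.natAbs = ∑ v ∈ range L, g (min v (L - v)) := by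
    refine Finset.sum_nbij' (fun k => k.val) (fun v => (v : ZMod L)) (fun k _ => mem_range.mpr (ZMod.val_lt k))
      (fun _ _ => mem_univ _) (fun k _ => ZMod.natCast_zmod_val k)
      (fun v hv => ZMod.val_cast_of_lt (mem_range.mp hv)) (fun k _ => by rw [ZMod.valMinAbs_natAbs_eq_min])
  rw [h1, ← Finset.sum_filter_add_sum_filter_not (range L) (fun v => v ≤ L - v), two_mul]
  gcongr
  · -- the lower half maps into `[0, L/2]` identically
    calc ∑ v ∈ (range L).filter (fun v => v ≤ L - v), g (min v (L - v))
        = ∑ v ∈ (range L).filter (fun v => v ≤ L - v), g v :=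
          Finset.sum_congr rfl fun v hv => by rw [min_eq_left (mem_filter.mp hv).2]
      _ ≤ ∑ j ∈ range (L / 2 + 1), g j := by
          refine Finset.sum_le_sum_of_subset_of_nonneg (fun v hv => ?_) (fun j _ _ => hg j)
          have h := mem_filter.mp hv
          have := mem_range.mp h.1
          exact mem_range.mpr (by omega)
  · -- the upper half maps into `[0, L/2]` under `v ↦ L - v`
    calc ∑ v ∈ (range L).filter (fun v => ¬ v ≤ L - v), g (min v (L - v))
        = ∑ v ∈ (range L).filter (fun v => ¬ v ≤ L - v), g (L - v) :=
          Finset.sum_congr rfl fun v hv => by rw [min_eq_right (le_of_not_ge (mem_filter.mp hv).2)]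
      _ = ∑ j ∈ ((range L).filter (fun v => ¬ v ≤ L - v)).image (fun v => L - v), g j := by
          rw [Finset.sum_image]
          intro v hv v' hv' h
          have := mem_range.mp (mem_filter.mp hv).1
          have := mem_range.mp (mem_filter.mp hv').1
          simp only at h
          omega
      _ ≤ ∑ j ∈ range (L / 2 + 1), g j := by
          refine Finset.sum_le_sum_of_subset_of_nonneg (fun j hj => ?_) (fun j _ _ => hg j)
          obtain ⟨v, hv, rfl⟩ := mem_image.mp hj
          have h := mem_filter.mp hv
          have := mem_range.mp h.1
          exact mem_range.mpr (by omega)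

/-- Picking out the terms `k = 0, 1, …, m` (`m < L`) of a sum of non-negative terms over `ZMod L`. -/
theorem sum_range_cast_le (f : ZMod L → ℝ) (hf : ∀ k, 0 ≤ f k) {m : ℕ} (hm : m < L) :
    ∑ j ∈ range (m + 1), f (j : ZMod L) ≤ ∑ k : ZMod L, f k := by
  rw [← Finset.sum_image (s := range (m + 1)) (g := fun j : ℕ => (j : ZMod L)) (f := f) ?_]
  · exact Finset.sum_le_sum_of_subset_of_nonneg (fun _ _ => mem_univ _) (fun k _ _ => hf k)
  · intro j hj j' hj' h
    have hj := mem_range.mp hj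
    have hj' := mem_range.mp hj'
    have := congrArg ZMod.val h
    rwa [ZMod.val_cast_of_lt (by omega), ZMod.val_cast_of_lt (by omega)] at this

/-! ## The kernel `q`, its diagonal `q(s,0)` and the weight `w`

The defining equations, used as hypotheses throughout:
* `hε : ∀ k, ε k = 2 - 2 * Real.cos (2 * Real.pi * (k.val : ℝ) / L)`,
* `hq : ∀ s m, q s m = (∑ k, Real.exp (-(s * ε k)) * Real.cos (2 * Real.pi * (k.val : ℝ) * (m.val : ℝ) / L)) / L`,
* `hw : ∀ s, w s = (∑ k, ε k * Real.exp (-(s * ε k))) / L`. -/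

section Kernel

variable {ε : ZMod L → ℝ} {q : ℝ → ZMod L → ℝ} {w : ℝ → ℝ}

/-- The diagonal value: `q(s,0) = (1/L) ∑_k exp(-s ε(k))`. -/
theorem q_zero (hq : ∀ s m, q s m = (∑ k : ZMod L, Real.exp (-(s * ε k)) *
      Real.cos (2 * Real.pi * (k.val : ℝ) * (m.val : ℝ) / L)) / L) (s : ℝ) :
    q s 0 = (∑ k : ZMod L, Real.exp (-(s * ε k))) / L := by
  rw [hq]
  simp

/-- Positive Fourier coefficients: `|q(s,m)| ≤ q(s,0)`. -/
theorem abs_q_le (hq : ∀ s m, q s m = (∑ k : ZMod L, Real.exp (-(s * ε k)) *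
      Real.cos (2 * Real.pi * (k.val : ℝ) * (m.val : ℝ) / L)) / L) (s : ℝ) (m : ZMod L) :
    |q s m| ≤ q s 0 := by
  rw [hq, q_zero hq, abs_div, Nat.abs_cast]
  gcongr
  refine (Finset.abs_sum_le_sum_abs _ _).trans (Finset.sum_le_sum fun k _ => ?_)
  rw [abs_mul, Real.abs_exp]
  exact mul_le_of_le_one_right (Real.exp_nonneg _) (Real.abs_cos_le_one _)

/-- `q(s,m) ≤ q(s,0)`. -/
theorem q_le_q_zero (hq : ∀ s m, q s m = (∑ k : ZMod L, Real.exp (-(s * ε k)) *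
      Real.cos (2 * Real.pi * (k.val : ℝ) * (m.val : ℝ) / L)) / L) (s : ℝ) (m : ZMod L) :
    q s m ≤ q s 0 := (le_abs_self _).trans (abs_q_le hq s m)

/-- `q(s,0) ≤ 1` for `s ≥ 0`. -/
theorem q_zero_le_one (hε : ∀ k, ε k = 2 - 2 * Real.cos (2 * Real.pi * (k.val : ℝ) / L))
    (hq : ∀ s m, q s m = (∑ k : ZMod L, Real.exp (-(s * ε k)) *
      Real.cos (2 * Real.pi * (k.val : ℝ) * (m.val : ℝ) / L)) / L) {s : ℝ} (hs : 0 ≤ s) :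
    q s 0 ≤ 1 := by
  have hL : (0 : ℝ) < L := by exact_mod_cast NeZero.pos L
  rw [q_zero hq, div_le_one hL]
  calc ∑ k : ZMod L, Real.exp (-(s * ε k)) ≤ ∑ _k : ZMod L, (1 : ℝ) :=
        Finset.sum_le_sum fun k _ => Real.exp_le_one_iff.mpr (by
          have h0 : 0 ≤ ε k := by rw [hε]; exact eps_nonneg k
          nlinarith)
    _ = L := by simp

/-- `1/L ≤ q(s,0)`: the zero mode alone. -/
theorem inv_le_q_zero (hε : ∀ k, ε k = 2 - 2 * Real.cos (2 * Real.pi * (k.val : ℝ) / L))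
    (hq : ∀ s m, q s m = (∑ k : ZMod L, Real.exp (-(s * ε k)) *
      Real.cos (2 * Real.pi * (k.val : ℝ) * (m.val : ℝ) / L)) / L) (s : ℝ) :
    1 / (L : ℝ) ≤ q s 0 := by
  rw [q_zero hq]
  gcongr
  have h1 : (1 : ℝ) = ∑ j ∈ range (0 + 1), Real.exp (-(s * ε ((j : ℕ) : ZMod L))) := by
    simp [hε]
  rw [h1]
  exact sum_range_cast_le (fun k => Real.exp (-(s * ε k))) (fun k => Real.exp_nonneg _) (NeZero.pos L)

/-- Evenness of the dispersion: `ε(-k) = ε(k)`. -/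
theorem eps_neg (hε : ∀ k, ε k = 2 - 2 * Real.cos (2 * Real.pi * (k.val : ℝ) / L)) (k : ZMod L) :
    ε (-k) = ε k := by
  have hL : (L : ℝ) ≠ 0 := Nat.cast_ne_zero.mpr (NeZero.ne L)
  rw [hε, hε, ZMod.neg_val]
  split_ifs with hk
  · subst hk
    simp
  · rw [Nat.cast_sub (ZMod.val_lt k).le]
    have e : 2 * Real.pi * ((L : ℝ) - (k.val : ℝ)) / L = ((1 : ℕ) : ℝ) * (2 * Real.pi) - 2 * Real.pi * (k.val : ℝ) / L := by
      rw [Nat.cast_one]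
      field_simp
    rw [e, Real.cos_nat_mul_two_pi_sub]

/-- Evenness of the kernel: `q(s,-m) = q(s,m)`. -/
theorem q_neg (hq : ∀ s m, q s m = (∑ k : ZMod L, Real.exp (-(s * ε k)) *
      Real.cos (2 * Real.pi * (k.val : ℝ) * (m.val : ℝ) / L)) / L) (s : ℝ) (m : ZMod L) :
    q s (-m) = q s m := by
  have hL : (L : ℝ) ≠ 0 := Nat.cast_ne_zero.mpr (NeZero.ne L)
  rw [hq, hq]
  congr 1
  refine Finset.sum_congr rfl fun k _ => ?_
  rw [ZMod.neg_val]
  split_ifs with hm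
  · subst hm
    simp
  · rw [Nat.cast_sub (ZMod.val_lt m).le]
    have e : 2 * Real.pi * (k.val : ℝ) * ((L : ℝ) - (m.val : ℝ)) / L =
        (k.val : ℝ) * (2 * Real.pi) - 2 * Real.pi * (k.val : ℝ) * (m.val : ℝ) / L := by
      field_simp
    rw [e, Real.cos_nat_mul_two_pi_sub]

/-- The sine sums vanish: `∑_k exp(-s ε(k)) sin(2π k x/L) = 0` (the involution `k ↦ -k`). -/
theorem sum_exp_mul_sin (hε : ∀ k, ε k = 2 - 2 * Real.cos (2 * Real.pi * (k.val : ℝ) / L))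
    (s : ℝ) (x : ℤ) :
    ∑ k : ZMod L, Real.exp (-(s * ε k)) * Real.sin (2 * Real.pi * (k.val : ℝ) * x / L) = 0 := by
  have hL : (L : ℝ) ≠ 0 := Nat.cast_ne_zero.mpr (NeZero.ne L)
  set f : ZMod L → ℝ := fun k => Real.exp (-(s * ε k)) * Real.sin (2 * Real.pi * (k.val : ℝ) * x / L) with hf
  have hodd : ∀ k, f (-k) = -f k := by
    intro k
    simp only [hf, eps_neg hε]
    rw [ZMod.neg_val]
    split_ifs with hk
    · subst hk
      simp
    · rw [Nat.cast_sub (ZMod.val_lt k).le]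
      have e : 2 * Real.pi * ((L : ℝ) - (k.val : ℝ)) * x / L =
          (x : ℝ) * (2 * Real.pi) - 2 * Real.pi * (k.val : ℝ) * x / L := by
        field_simp
      rw [e, Real.sin_int_mul_two_pi_sub]
      ring
  have h : ∑ k, f k = ∑ k, f (-k) :=
    (Fintype.sum_equiv (Equiv.neg (ZMod L)) (fun k => f (-k)) f (fun k => by simp)).symm
  simp only [hodd, Finset.sum_neg_distrib] at h
  change ∑ k, f k = 0
  linarith

/-- `0 ≤ w(s)`. -/
theorem w_nonneg (hε : ∀ k, ε k = 2 - 2 * Real.cos (2 * Real.pi * (k.val : ℝ) / L))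
    (hw : ∀ s, w s = (∑ k : ZMod L, ε k * Real.exp (-(s * ε k))) / L) (s : ℝ) : 0 ≤ w s := by
  rw [hw]
  exact div_nonneg (Finset.sum_nonneg fun k _ =>
    mul_nonneg (by rw [hε]; exact eps_nonneg k) (Real.exp_nonneg _)) (Nat.cast_nonneg _)

/-- `w(s) ≤ 4 exp(-16 s/L²)` for `s ≥ 0`: the zero mode does not contribute, every other mode has
`ε ≤ 4` and `ε ≥ 16κ²/L² ≥ 16/L²`. -/
theorem w_le_exp (hε : ∀ k, ε k = 2 - 2 * Real.cos (2 * Real.pi * (k.val : ℝ) / L))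
    (hw : ∀ s, w s = (∑ k : ZMod L, ε k * Real.exp (-(s * ε k))) / L) {s : ℝ} (hs : 0 ≤ s) :
    w s ≤ 4 * Real.exp (-(16 * s / (L : ℝ) ^ 2)) := by
  have hL : (0 : ℝ) < L := by exact_mod_cast NeZero.pos L
  rw [hw, div_le_iff₀ hL]
  calc ∑ k : ZMod L, ε k * Real.exp (-(s * ε k))
      ≤ ∑ _k : ZMod L, 4 * Real.exp (-(16 * s / (L : ℝ) ^ 2)) := by
        refine Finset.sum_le_sum fun k _ => ?_
        by_cases hk : k = 0
        · subst hk
          have h0 : ε 0 = 0 := by rw [hε]; simp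
          rw [h0, zero_mul]
          positivity
        · have h1 : ε k ≤ 4 := by rw [hε]; exact eps_le_four k
          have h2a : Real.exp (-(s * ε k)) ≤
              Real.exp (-(16 * s / (L : ℝ) ^ 2 * (k.valMinAbs.natAbs : ℝ) ^ 2)) := by
            rw [hε]; exact exp_eps_le k hs
          have h2 : Real.exp (-(s * ε k)) ≤ Real.exp (-(16 * s / (L : ℝ) ^ 2)) := by
            refine h2a.trans ?_
            rw [Real.exp_le_exp, neg_le_neg_iff]
            have hκ : (1 : ℝ) ≤ k.valMinAbs.natAbs := by exact_mod_cast one_le_fold hk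
            have hκ2 : (1 : ℝ) ≤ (k.valMinAbs.natAbs : ℝ) ^ 2 := by nlinarith
            have h16 : 0 ≤ 16 * s / (L : ℝ) ^ 2 := by positivity
            calc 16 * s / (L : ℝ) ^ 2 = 16 * s / (L : ℝ) ^ 2 * 1 := by ring
              _ ≤ 16 * s / (L : ℝ) ^ 2 * (k.valMinAbs.natAbs : ℝ) ^ 2 := by gcongr
          have h3 : 0 ≤ ε k := by rw [hε]; exact eps_nonneg k
          calc ε k * Real.exp (-(s * ε k)) ≤ 4 * Real.exp (-(s * ε k)) := by gcongr
            _ ≤ 4 * Real.exp (-(16 * s / (L : ℝ) ^ 2)) := by gcongr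
    _ = 4 * Real.exp (-(16 * s / (L : ℝ) ^ 2)) * L := by
        simp
        ring

/-- `w(s) ≤ 4` for `s ≥ 0`. -/
theorem w_le_four (hε : ∀ k, ε k = 2 - 2 * Real.cos (2 * Real.pi * (k.val : ℝ) / L))
    (hw : ∀ s, w s = (∑ k : ZMod L, ε k * Real.exp (-(s * ε k))) / L) {s : ℝ} (hs : 0 ≤ s) :
    w s ≤ 4 := by
  refine (w_le_exp hε hw hs).trans ?_
  have hL : (0 : ℝ) < L := by exact_mod_cast NeZero.pos L
  have : Real.exp (-(16 * s / (L : ℝ) ^ 2)) ≤ 1 := Real.exp_le_one_iff.mpr (by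
    have : 0 ≤ 16 * s / (L : ℝ) ^ 2 := by positivity
    linarith)
  linarith

/-- Continuity of `s ↦ q(s,m)`. -/
theorem continuous_q (hq : ∀ s m, q s m = (∑ k : ZMod L, Real.exp (-(s * ε k)) *
      Real.cos (2 * Real.pi * (k.val : ℝ) * (m.val : ℝ) / L)) / L) (m : ZMod L) :
    Continuous fun s => q s m := by
  have h : (fun s => q s m) = fun s => (∑ k : ZMod L, Real.exp (-(s * ε k)) *
      Real.cos (2 * Real.pi * (k.val : ℝ) * (m.val : ℝ) / L)) / L := funext fun s => hq s m
  rw [h]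
  fun_prop

/-- Continuity of `w`. -/
theorem continuous_w (hw : ∀ s, w s = (∑ k : ZMod L, ε k * Real.exp (-(s * ε k))) / L) :
    Continuous w := by
  have h : w = fun s => (∑ k : ZMod L, ε k * Real.exp (-(s * ε k))) / L := funext hw
  rw [h]
  fun_prop

end Kernel

end CycleKernel

/-- **Folding estimate** (registered helper stub `CycleFoldingEstimate` of stmt-QuantumFields-9365). -/
theorem CycleFoldingEstimate : ∀ (L : ℕ) [NeZero L] (g : ℕ → ℝ), (∀ j, 0 ≤ g j) →
    ∑ k : ZMod L, g k.valMinAbs.natAbs ≤ 2 * ∑ j ∈ Finset.range (L / 2 + 1), g j :=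
  fun _ _ g hg => CycleKernel.sum_fold_le g hg

end Summit.QuantumFields.YangMills.Theorems.FemtoCurvatureSkewness

end
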